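import Summits.QuantumFields.BalabanUV.Beta.FP.PackedLegBlocksAtSlices

/-!
# `BalabanUV.Beta.FP.PackedLegOneShotSockets` — road «FP» for binder row D1, ROUTE T, (T-INV) row AT THE (S3-1) ONE-SHOT SOCKETS of the (T-ID) assembly
# (the OWNER d1-p3 g27's #41d `TowerLawFullIndex` (S3-1)-N ∕ (S3-1)-F binders `hXN hEAN hAEN hLN` ∕ `hXF hEAF hAEF hLF`, #40b `LevelZeroLawFullIndex` (S3-1)-N;
# SPEC #42 (3) «LEGS (S3-1) N and F … CHECK the index spelling … or ask leaf-05 for the `M′`-spelled twin»):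
# **THE FOUR (S3-1) SOCKETS OF A ONE-SHOT SYSTEM FROM A CHART's SEVEN LETTERS AND TWO BLOCK IDENTIFICATIONS, IN THE TOWER's OWN SPELLING**

WHY.  #41d displays, per one-shot system X ∈ {N, F}, a right inverse `hX_X : kkt H₀ [𝔔; P] * X = 1`, the torus rules `hEA_X ∕ hAE_X : Ê·Â = Â = Â·Ê` and the
packed leg `hL_X : X.submatrix e e = fromBlocks Γ I L (−S)` over a chart kernel `A_X` — «an2's composite one-shot chart + leaf-05 `packedLeg_oneShot_eq ∕
kkt_mul_inv_oneShot` discharge them together at the record».  This file IS that «together», typed once, so that the (C1) supplier delivers per system EXACTLY: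
the seven chart letters of `(A, 𝕄)` at scale `bigRatio Lc m`, root `bigRoot Lc rs m` (`hA hMh hAt hMt hrel hmm hanti` — DISPLAYED here, an2's (C1)), the slot
presentation (`fμ hfμ hμ hcoarse`), and TWO BLOCK IDENTIFICATIONS `hH : M̂|ff = H₀`, `hQ : M̂.submatrix fμ (ff) = 𝔔` (`M̂ := perF T 𝕄`) — and receives the four
sockets in #41d's binder text with `X := (kkt H₀ [𝔔; bigP])⁻¹`, `ρ := bigRoot Lc rs m`, `L := bigRatio Lc m`:
* §1 (any depth `m`, coarse torus `M`, finest torus `T = towerTorus Lc M m`): `perF_rules_oneShot_of_relInv` (the four matrix rules at the one-shot scale —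
  `RelInvPeriodisedChart.perF_rules_of_relInv` at `(bigRatio Lc m, towerTorus Lc M m, bigRoot Lc rs m)`; not in the tree at this slice before),
  `kkt_mul_inv_oneShot_of_blocks`, `packedLeg_oneShot_eq_of_blocks` (leaf-05 g31 `kkt_mul_inv_oneShot ∕ packedLeg_oneShot_eq` after `subst hH hQ`);
* §2 THE TOWER's SPELLING (SPEC #42 (3)'s CHECK, done in the kernel): for the tower `towerTorus Lc M′ (n+1)` of #21 ∕ #41c ∕ #41d —
  N (depth `n+1` over `(M′, rs)`): `towerN_rules ∕ towerN_rightInverse ∕ towerN_leg` = §1 verbatim;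
  F (depth `n` over `(fine Lc M′, rs ∘ succ)`, EVERY torus spelled `towerTorus Lc M′ (n+1)` as #41d :209–223 spells it, slots `fF : (pbox M′ × Fin) → Idx T`,
  rows `bigP Lc (fine Lc M′) (rs ∘ succ) … n`): `towerF_rules ∕ towerF_rightInverse ∕ towerF_leg` = §1 at `(fine Lc M′, rs ∘ succ, n)` by `exact` — the
  definitional unfolding `towerTorus Lc M′ (n+1) = towerTorus Lc (fine Lc M′) n` (`TorusCompositeObjects.towerTorus_succ`, `rfl`) passes the elaborator at
  these statements, so NO `M′`-spelled twin of the block letters is needed.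
[folklore] block bookkeeping BY NAME over OUR typed objects; no `def`, no `def … : Prop`, nothing cited, 0 sorry; 0 estimates.  What it is NOT: not the composite
one-shot charts `(A_N, 𝕄_N)`, `(A_F, 𝕄_F)` nor their seven letters nor the two block identifications (an2's (C1) — DISPLAYED binders here); not the (S3-2)
namings; not the de-periodisation ((P2‴)); not (L2′).

HONEST DEPENDENCY (page 1, mandatory): continuum YM on T⁴ ⇐ BetaPertH ∧ nine spine estimates (0/9 proved); BetaPertH ⇐ (D1) ∧ (D4) ∧ CAP+tail;
G-an2-4 gates asym, D1 and NE2/3/4.  HONEST FRAMING (cell contract, verbatim): «discharging `BetaPertH` makes Bałaban's UV stability UNCONDITIONAL —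
a real constructive-QFT result; it is NOT the continuum limit and NOT the Clay problem.»  ABSOLUTE RULE (cell charter, verbatim): «No internally-minted
statement may enter as a cited fact. Every hypothesis is either kernel-proved in this package or a verbatim quotation of a PUBLISHED theorem with page
reference. The manuscript(s) under audit are NOT citable for their own disputed steps — they are the thing under adjudication; programme-internal
(2001/route/tribunal) claims are never citable.»  Nothing of Bałaban's asserted; 0∕4 row-D1 binders (hW, hR, D1Tel, D1Rep); NOT (T-ID), NOT SDF, NOT D1,
NOT BetaPertH, NOT continuum, NOT Clay.  Provenance: D1 formalisation swarm, unit `b2b-balaban-beta-d1-formalise-leaf-05` gen 37, 2026-08-23.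
No existing file touched.
-/

noncomputable section

open scoped BigOperators Matrix

namespace Summit.QuantumFields.BalabanUV.Beta.FP.PackedLegOneShotSockets

open Matrix
open Literature.Probability.LatticeModels (Torus.proj)
open Literature.MathematicalPhysics.QuantumFieldTheory.Balaban1983to89
open Literature.MathematicalPhysics.QuantumFieldTheory.Balaban1983to89.Beta
open Literature.MathematicalPhysics.QuantumFieldTheory.Balaban1983to89.Beta.Composition (kkt)
open B5Prop11Plancherel (fine)
open B6Lemma24Torus (pbox)
open ExpKernelCalculus (MKer shiftK)
open AffineAveraging (Site box toSite)
open OneStepResolventKernel (Fib)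
open Summit.QuantumFields.BalabanUV.Beta.TameKernelCalculus (Spr)
open Summit.QuantumFields.BalabanUV.Beta.ChartConjugationRelative (RelInv)
open Summit.QuantumFields.BalabanUV.Beta.AxialDressingRooted (axEc)
open Summit.QuantumFields.BalabanUV.Beta.FP.KernelPeriodisationFib (Idx perF)
open Summit.QuantumFields.BalabanUV.Beta.FP.TorusCompositeObjects (towerTorus bigRatio bigRatio_pos bigRoot bigP NParam)
open Summit.QuantumFields.BalabanUV.Beta.FP.TorusCompositeUnimodular (bigRatio_dvd_towerTorus)
open Summit.QuantumFields.BalabanUV.Beta.FP.RelInvPeriodisedChart (perF_rules_of_relInv)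
open Summit.QuantumFields.BalabanUV.Beta.FP.PackedLegBlocksAtSlices (packedLeg_oneShot_eq kkt_mul_inv_oneShot)

/-! ## §1 Any depth `m`: the four (S3-1) sockets of the one-shot system from the chart's seven letters and two block identifications -/

section Generic

variable {d : ℕ} (Lc : ℕ) [NeZero Lc] (M : Fin (d + 1) → ℕ) [∀ μ, NeZero (M μ)] (rs : ℕ → (Fin (d + 1) → ℕ))
  (hrs : ∀ k i, 0 ≤ toSite (rs k) i ∧ toSite (rs k) i < (Lc : ℤ)) (m : ℕ) {A Mh : MKer (d + 1) (Fib d)}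

/-- [folklore] **THE FOUR MATRIX RULES AT THE ONE-SHOT SLICE, ANY CHART** (#41d's `hEA_X ∕ hAE_X` and the two sandwich rules): for a lattice chart `(A, 𝕄)`
with spread, `bigRatio Lc m • ℤ^{d+1}`-invariance and `RelInv A 𝕄 (axEc (bigRoot Lc rs m) (bigRatio Lc m))`, on `T := towerTorus Lc M m` (`Lc ∣ M_i`):
`Ê·Â = Â`, `Â·Ê = Â`, `Â·M̂·Ê = Ê`, `Ê·M̂·Â = Ê` — `RelInvPeriodisedChart.perF_rules_of_relInv` at scale `bigRatio Lc m` (`bigRatio_dvd_towerTorus`). -/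
theorem perF_rules_oneShot_of_relInv (hM : ∀ i, Lc ∣ M i) (hA : Spr A) (hMh : Spr Mh)
    (hAt : ∀ t : Fin (d + 1) → ℤ, shiftK ((bigRatio Lc m : ℤ) • t) A = A) (hMt : ∀ t : Fin (d + 1) → ℤ, shiftK ((bigRatio Lc m : ℤ) • t) Mh = Mh)
    (hrel : RelInv A Mh (axEc (bigRoot Lc rs m) (bigRatio Lc m))) :
    perF (towerTorus Lc M m) (axEc (bigRoot Lc rs m) (bigRatio Lc m)) * perF (towerTorus Lc M m) A = perF (towerTorus Lc M m) A
      ∧ perF (towerTorus Lc M m) A * perF (towerTorus Lc M m) (axEc (bigRoot Lc rs m) (bigRatio Lc m)) = perF (towerTorus Lc M m) A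
      ∧ perF (towerTorus Lc M m) A * perF (towerTorus Lc M m) Mh * perF (towerTorus Lc M m) (axEc (bigRoot Lc rs m) (bigRatio Lc m))
          = perF (towerTorus Lc M m) (axEc (bigRoot Lc rs m) (bigRatio Lc m))
      ∧ perF (towerTorus Lc M m) (axEc (bigRoot Lc rs m) (bigRatio Lc m)) * perF (towerTorus Lc M m) Mh * perF (towerTorus Lc M m) A
          = perF (towerTorus Lc M m) (axEc (bigRoot Lc rs m) (bigRatio Lc m)) := by
  have hLc : 0 < Lc := Nat.pos_of_ne_zero (NeZero.ne Lc)
  haveI : NeZero (bigRatio Lc m) := ⟨(bigRatio_pos Lc hLc m).ne'⟩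
  exact perF_rules_of_relInv (Lc := bigRatio Lc m) (towerTorus Lc M m) (bigRoot Lc rs m) (bigRatio_dvd_towerTorus Lc hM m) hA hMh hAt hMt hrel

set_option synthInstance.maxSize 1024 in
/-- [folklore] **THE RIGHT-INVERSE SOCKET AFTER THE BLOCK IDENTIFICATIONS** (#41d's `hX_X`): with the seven letters, a slot presentation `fμ` and
`hH : M̂|ff = H₀`, `hQ : M̂.submatrix fμ (ff) = 𝔔`:  `kkt H₀ [𝔔; bigP Lc M rs hrs m] * (kkt H₀ [𝔔; bigP …])⁻¹ = 1` (leaf-05 g31 `kkt_mul_inv_oneShot`). -/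
theorem kkt_mul_inv_oneShot_of_blocks (hM : ∀ i, Lc ∣ M i) (hA : Spr A) (hMh : Spr Mh)
    (hAt : ∀ t : Fin (d + 1) → ℤ, shiftK ((bigRatio Lc m : ℤ) • t) A = A) (hMt : ∀ t : Fin (d + 1) → ℤ, shiftK ((bigRatio Lc m : ℤ) • t) Mh = Mh)
    (hrel : RelInv A Mh (axEc (bigRoot Lc rs m) (bigRatio Lc m)))
    (hmm : ∀ (x y : Fin (d + 1) → ℤ) (κ l : Fin (d + 1)), Mh x y (Sum.inr κ) (Sum.inr l) = 0)
    (hanti : ∀ (x y : Fin (d + 1) → ℤ) (κ l : Fin (d + 1)), Mh x y (Sum.inl κ) (Sum.inr l) = -Mh y x (Sum.inr l) (Sum.inl κ))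
    {μ : Type*} [Fintype μ] [DecidableEq μ] (fμ : μ → Idx (towerTorus Lc M m) (Fib d)) (hfμ : Function.Injective fμ)
    (hμ : ∀ a : μ, ∃ m' : Fin (d + 1), (fμ a).2 = Sum.inr m')
    (hcoarse : ∀ (s : ↥(pbox (towerTorus Lc M m))) (m' : Fin (d + 1)),
      ((s, Sum.inr m') : Idx (towerTorus Lc M m) (Fib d)) ∈ Set.range fμ ↔ Torus.proj (bigRatio Lc m) (s : Site (d + 1)) = 0)
    {H₀ : Matrix (↥(pbox (towerTorus Lc M m)) × Fin (d + 1)) (↥(pbox (towerTorus Lc M m)) × Fin (d + 1)) ℝ}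
    (hH : (perF (towerTorus Lc M m) Mh).submatrix (fun b : ↥(pbox (towerTorus Lc M m)) × Fin (d + 1) => ((b.1, Sum.inl b.2) : Idx (towerTorus Lc M m) (Fib d)))
        (fun b : ↥(pbox (towerTorus Lc M m)) × Fin (d + 1) => ((b.1, Sum.inl b.2) : Idx (towerTorus Lc M m) (Fib d))) = H₀)
    {𝔔 : Matrix μ (↥(pbox (towerTorus Lc M m)) × Fin (d + 1)) ℝ}
    (hQ : (perF (towerTorus Lc M m) Mh).submatrix fμ (fun b : ↥(pbox (towerTorus Lc M m)) × Fin (d + 1) => ((b.1, Sum.inl b.2) : Idx (towerTorus Lc M m) (Fib d))) = 𝔔) :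
    kkt H₀ (fromRows 𝔔 (bigP Lc M rs hrs m)) * (kkt H₀ (fromRows 𝔔 (bigP Lc M rs hrs m)))⁻¹ = 1 := by
  subst hH hQ
  exact kkt_mul_inv_oneShot Lc M rs hrs m hM hA hMh hAt hMt hrel hmm hanti fμ hfμ hμ hcoarse

set_option synthInstance.maxSize 1024 in
/-- [folklore] **THE PACKED LEG AFTER THE BLOCK IDENTIFICATIONS** (#41d's `hL_X`, #39's `hL` orientation `(Γ, I, L, −S)`): with the same data,
`((kkt H₀ [𝔔; bigP …])⁻¹).submatrix (Sum.map id inl) (Sum.map id inl) = fromBlocks (of (Ê_bb·Ê_b′b′·Â_bb′)) (of (Ê_bb·Â_{b,fμ a})) (−of (Ê_bb·Â_{fμ a,b})) (−Â.submatrix fμ fμ)`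
with `Ê := axEc (bigRoot Lc rs m) (bigRatio Lc m)`, `Â := perF T A` (leaf-05 g31 `packedLeg_oneShot_eq`). -/
theorem packedLeg_oneShot_eq_of_blocks (hM : ∀ i, Lc ∣ M i) (hA : Spr A) (hMh : Spr Mh)
    (hAt : ∀ t : Fin (d + 1) → ℤ, shiftK ((bigRatio Lc m : ℤ) • t) A = A) (hMt : ∀ t : Fin (d + 1) → ℤ, shiftK ((bigRatio Lc m : ℤ) • t) Mh = Mh)
    (hrel : RelInv A Mh (axEc (bigRoot Lc rs m) (bigRatio Lc m)))
    (hmm : ∀ (x y : Fin (d + 1) → ℤ) (κ l : Fin (d + 1)), Mh x y (Sum.inr κ) (Sum.inr l) = 0)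
    (hanti : ∀ (x y : Fin (d + 1) → ℤ) (κ l : Fin (d + 1)), Mh x y (Sum.inl κ) (Sum.inr l) = -Mh y x (Sum.inr l) (Sum.inl κ))
    {μ : Type*} [Fintype μ] [DecidableEq μ] (fμ : μ → Idx (towerTorus Lc M m) (Fib d)) (hfμ : Function.Injective fμ)
    (hμ : ∀ a : μ, ∃ m' : Fin (d + 1), (fμ a).2 = Sum.inr m')
    (hcoarse : ∀ (s : ↥(pbox (towerTorus Lc M m))) (m' : Fin (d + 1)),
      ((s, Sum.inr m') : Idx (towerTorus Lc M m) (Fib d)) ∈ Set.range fμ ↔ Torus.proj (bigRatio Lc m) (s : Site (d + 1)) = 0)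
    {H₀ : Matrix (↥(pbox (towerTorus Lc M m)) × Fin (d + 1)) (↥(pbox (towerTorus Lc M m)) × Fin (d + 1)) ℝ}
    (hH : (perF (towerTorus Lc M m) Mh).submatrix (fun b : ↥(pbox (towerTorus Lc M m)) × Fin (d + 1) => ((b.1, Sum.inl b.2) : Idx (towerTorus Lc M m) (Fib d)))
        (fun b : ↥(pbox (towerTorus Lc M m)) × Fin (d + 1) => ((b.1, Sum.inl b.2) : Idx (towerTorus Lc M m) (Fib d))) = H₀)
    {𝔔 : Matrix μ (↥(pbox (towerTorus Lc M m)) × Fin (d + 1)) ℝ}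
    (hQ : (perF (towerTorus Lc M m) Mh).submatrix fμ (fun b : ↥(pbox (towerTorus Lc M m)) × Fin (d + 1) => ((b.1, Sum.inl b.2) : Idx (towerTorus Lc M m) (Fib d))) = 𝔔) :
    ((kkt H₀ (fromRows 𝔔 (bigP Lc M rs hrs m)))⁻¹).submatrix (Sum.map id Sum.inl) (Sum.map id Sum.inl)
      = fromBlocks
          (Matrix.of fun (b b' : ↥(pbox (towerTorus Lc M m)) × Fin (d + 1)) =>
          axEc (bigRoot Lc rs m) (bigRatio Lc m) (b.1 : Site (d + 1)) (b.1 : Site (d + 1)) (Sum.inl b.2) (Sum.inl b.2)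
            * (axEc (bigRoot Lc rs m) (bigRatio Lc m) (b'.1 : Site (d + 1)) (b'.1 : Site (d + 1)) (Sum.inl b'.2) (Sum.inl b'.2)
              * perF (towerTorus Lc M m) A (b.1, Sum.inl b.2) (b'.1, Sum.inl b'.2)))
          (Matrix.of fun (b : ↥(pbox (towerTorus Lc M m)) × Fin (d + 1)) (a : μ) =>
          axEc (bigRoot Lc rs m) (bigRatio Lc m) (b.1 : Site (d + 1)) (b.1 : Site (d + 1)) (Sum.inl b.2) (Sum.inl b.2)
            * perF (towerTorus Lc M m) A (b.1, Sum.inl b.2) (fμ a))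
          (-Matrix.of fun (a : μ) (b : ↥(pbox (towerTorus Lc M m)) × Fin (d + 1)) =>
          axEc (bigRoot Lc rs m) (bigRatio Lc m) (b.1 : Site (d + 1)) (b.1 : Site (d + 1)) (Sum.inl b.2) (Sum.inl b.2)
            * perF (towerTorus Lc M m) A (fμ a) (b.1, Sum.inl b.2))
          (-((perF (towerTorus Lc M m) A).submatrix fμ fμ)) := by
  subst hH hQ
  exact packedLeg_oneShot_eq Lc M rs hrs m hM hA hMh hAt hMt hrel hmm hanti fμ hfμ hμ hcoarse

end Generic

/-! ## §2 The tower's spelling (SPEC #42 (3)): N at depth `n+1` over `(M′, rs)`, F at depth `n` over `(fine Lc M′, rs ∘ succ)`, both on `towerTorus Lc M′ (n+1)` -/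

section Tower

variable {d : ℕ} (M' : Fin (d + 1) → ℕ) [∀ μ, NeZero (M' μ)] (Lc : ℕ) [NeZero Lc] (rs : ℕ → (Fin (d + 1) → ℕ))
  (hrs : ∀ k i, 0 ≤ toSite (rs k) i ∧ toSite (rs k) i < (Lc : ℤ)) (n : ℕ) {A Mh : MKer (d + 1) (Fib d)}

/-- [folklore] **(S3-1)-N, TORUS RULES** (#41d `hEAN ∕ hAEN` with `ρN := bigRoot Lc rs (n+1)`, `LNc := bigRatio Lc (n+1)`): §1 at `(M′, rs, n+1)`. -/
theorem towerN_rules (hM' : ∀ i, Lc ∣ M' i) (hA : Spr A) (hMh : Spr Mh)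
    (hAt : ∀ t : Fin (d + 1) → ℤ, shiftK ((bigRatio Lc (n + 1) : ℤ) • t) A = A) (hMt : ∀ t : Fin (d + 1) → ℤ, shiftK ((bigRatio Lc (n + 1) : ℤ) • t) Mh = Mh)
    (hrel : RelInv A Mh (axEc (bigRoot Lc rs (n + 1)) (bigRatio Lc (n + 1)))) :
    perF (towerTorus Lc M' (n + 1)) (axEc (bigRoot Lc rs (n + 1)) (bigRatio Lc (n + 1))) * perF (towerTorus Lc M' (n + 1)) A = perF (towerTorus Lc M' (n + 1)) A
      ∧ perF (towerTorus Lc M' (n + 1)) A * perF (towerTorus Lc M' (n + 1)) (axEc (bigRoot Lc rs (n + 1)) (bigRatio Lc (n + 1))) = perF (towerTorus Lc M' (n + 1)) A :=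
  ⟨(perF_rules_oneShot_of_relInv Lc M' rs (n + 1) hM' hA hMh hAt hMt hrel).1, (perF_rules_oneShot_of_relInv Lc M' rs (n + 1) hM' hA hMh hAt hMt hrel).2.1⟩

set_option synthInstance.maxSize 1024 in
/-- [folklore] **(S3-1)-N, RIGHT INVERSE** (#41d `hXN` with `XN := (kkt H₀ [𝔔₀; P])⁻¹`, `P = bigP Lc M′ rs _ (n+1)`): §1 at `(M′, rs, n+1)`; the block
identifications `hH : M̂_N|ff = H₀` (= #41d's `hH₀` right side) and `hQ : M̂_N.submatrix fN (ff) = 𝔔₀` (= `Q₂₀ * Q₁₀`, #41d's `h𝔔₀`) are (C1)'s. -/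
theorem towerN_rightInverse (hM' : ∀ i, Lc ∣ M' i) (hA : Spr A) (hMh : Spr Mh)
    (hAt : ∀ t : Fin (d + 1) → ℤ, shiftK ((bigRatio Lc (n + 1) : ℤ) • t) A = A) (hMt : ∀ t : Fin (d + 1) → ℤ, shiftK ((bigRatio Lc (n + 1) : ℤ) • t) Mh = Mh)
    (hrel : RelInv A Mh (axEc (bigRoot Lc rs (n + 1)) (bigRatio Lc (n + 1))))
    (hmm : ∀ (x y : Fin (d + 1) → ℤ) (κ l : Fin (d + 1)), Mh x y (Sum.inr κ) (Sum.inr l) = 0)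
    (hanti : ∀ (x y : Fin (d + 1) → ℤ) (κ l : Fin (d + 1)), Mh x y (Sum.inl κ) (Sum.inr l) = -Mh y x (Sum.inr l) (Sum.inl κ))
    {κ : Type*} [Fintype κ] [DecidableEq κ] (fN : κ → Idx (towerTorus Lc M' (n + 1)) (Fib d)) (hfN : Function.Injective fN)
    (hmN : ∀ a : κ, ∃ m : Fin (d + 1), (fN a).2 = Sum.inr m)
    (hcN : ∀ (s : ↥(pbox (towerTorus Lc M' (n + 1)))) (m : Fin (d + 1)),
      ((s, Sum.inr m) : Idx (towerTorus Lc M' (n + 1)) (Fib d)) ∈ Set.range fN ↔ Torus.proj (bigRatio Lc (n + 1)) (s : Site (d + 1)) = 0)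
    {H₀ : Matrix (↥(pbox (towerTorus Lc M' (n + 1))) × Fin (d + 1)) (↥(pbox (towerTorus Lc M' (n + 1))) × Fin (d + 1)) ℝ}
    (hH : (perF (towerTorus Lc M' (n + 1)) Mh).submatrix
        (fun b : ↥(pbox (towerTorus Lc M' (n + 1))) × Fin (d + 1) => ((b.1, Sum.inl b.2) : Idx (towerTorus Lc M' (n + 1)) (Fib d)))
        (fun b : ↥(pbox (towerTorus Lc M' (n + 1))) × Fin (d + 1) => ((b.1, Sum.inl b.2) : Idx (towerTorus Lc M' (n + 1)) (Fib d))) = H₀)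
    {𝔔₀ : Matrix κ (↥(pbox (towerTorus Lc M' (n + 1))) × Fin (d + 1)) ℝ}
    (hQ : (perF (towerTorus Lc M' (n + 1)) Mh).submatrix fN
        (fun b : ↥(pbox (towerTorus Lc M' (n + 1))) × Fin (d + 1) => ((b.1, Sum.inl b.2) : Idx (towerTorus Lc M' (n + 1)) (Fib d))) = 𝔔₀) :
    kkt H₀ (fromRows 𝔔₀ (bigP Lc M' rs hrs (n + 1))) * (kkt H₀ (fromRows 𝔔₀ (bigP Lc M' rs hrs (n + 1))))⁻¹ = 1 :=
  kkt_mul_inv_oneShot_of_blocks Lc M' rs hrs (n + 1) hM' hA hMh hAt hMt hrel hmm hanti fN hfN hmN hcN hH hQ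

set_option synthInstance.maxSize 1024 in
/-- [folklore] **(S3-1)-N, THE LEG** (#41d `hLN` :184–192 verbatim with `AN := A`, `ρN := bigRoot Lc rs (n+1)`, `LNc := bigRatio Lc (n+1)`): §1 at `(M′, rs, n+1)`. -/
theorem towerN_leg (hM' : ∀ i, Lc ∣ M' i) (hA : Spr A) (hMh : Spr Mh)
    (hAt : ∀ t : Fin (d + 1) → ℤ, shiftK ((bigRatio Lc (n + 1) : ℤ) • t) A = A) (hMt : ∀ t : Fin (d + 1) → ℤ, shiftK ((bigRatio Lc (n + 1) : ℤ) • t) Mh = Mh)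
    (hrel : RelInv A Mh (axEc (bigRoot Lc rs (n + 1)) (bigRatio Lc (n + 1))))
    (hmm : ∀ (x y : Fin (d + 1) → ℤ) (κ l : Fin (d + 1)), Mh x y (Sum.inr κ) (Sum.inr l) = 0)
    (hanti : ∀ (x y : Fin (d + 1) → ℤ) (κ l : Fin (d + 1)), Mh x y (Sum.inl κ) (Sum.inr l) = -Mh y x (Sum.inr l) (Sum.inl κ))
    {κ : Type*} [Fintype κ] [DecidableEq κ] (fN : κ → Idx (towerTorus Lc M' (n + 1)) (Fib d)) (hfN : Function.Injective fN)
    (hmN : ∀ a : κ, ∃ m : Fin (d + 1), (fN a).2 = Sum.inr m)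
    (hcN : ∀ (s : ↥(pbox (towerTorus Lc M' (n + 1)))) (m : Fin (d + 1)),
      ((s, Sum.inr m) : Idx (towerTorus Lc M' (n + 1)) (Fib d)) ∈ Set.range fN ↔ Torus.proj (bigRatio Lc (n + 1)) (s : Site (d + 1)) = 0)
    {H₀ : Matrix (↥(pbox (towerTorus Lc M' (n + 1))) × Fin (d + 1)) (↥(pbox (towerTorus Lc M' (n + 1))) × Fin (d + 1)) ℝ}
    (hH : (perF (towerTorus Lc M' (n + 1)) Mh).submatrix
        (fun b : ↥(pbox (towerTorus Lc M' (n + 1))) × Fin (d + 1) => ((b.1, Sum.inl b.2) : Idx (towerTorus Lc M' (n + 1)) (Fib d)))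
        (fun b : ↥(pbox (towerTorus Lc M' (n + 1))) × Fin (d + 1) => ((b.1, Sum.inl b.2) : Idx (towerTorus Lc M' (n + 1)) (Fib d))) = H₀)
    {𝔔₀ : Matrix κ (↥(pbox (towerTorus Lc M' (n + 1))) × Fin (d + 1)) ℝ}
    (hQ : (perF (towerTorus Lc M' (n + 1)) Mh).submatrix fN
        (fun b : ↥(pbox (towerTorus Lc M' (n + 1))) × Fin (d + 1) => ((b.1, Sum.inl b.2) : Idx (towerTorus Lc M' (n + 1)) (Fib d))) = 𝔔₀) :
    ((kkt H₀ (fromRows 𝔔₀ (bigP Lc M' rs hrs (n + 1))))⁻¹).submatrix (Sum.map id Sum.inl) (Sum.map id Sum.inl) = fromBlocks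
      (Matrix.of fun (b b' : (↥(pbox (towerTorus Lc M' (n + 1))) × Fin (d + 1))) =>
        axEc (bigRoot Lc rs (n + 1)) (bigRatio Lc (n + 1)) (b.1 : Site (d + 1)) (b.1 : Site (d + 1)) (Sum.inl b.2) (Sum.inl b.2)
          * (axEc (bigRoot Lc rs (n + 1)) (bigRatio Lc (n + 1)) (b'.1 : Site (d + 1)) (b'.1 : Site (d + 1)) (Sum.inl b'.2) (Sum.inl b'.2)
            * perF (towerTorus Lc M' (n + 1)) A (b.1, Sum.inl b.2) (b'.1, Sum.inl b'.2)))
      (Matrix.of fun (b : (↥(pbox (towerTorus Lc M' (n + 1))) × Fin (d + 1))) (a : κ) =>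
        axEc (bigRoot Lc rs (n + 1)) (bigRatio Lc (n + 1)) (b.1 : Site (d + 1)) (b.1 : Site (d + 1)) (Sum.inl b.2) (Sum.inl b.2)
          * perF (towerTorus Lc M' (n + 1)) A (b.1, Sum.inl b.2) (fN a))
      (-Matrix.of fun (a : κ) (b : (↥(pbox (towerTorus Lc M' (n + 1))) × Fin (d + 1))) =>
        axEc (bigRoot Lc rs (n + 1)) (bigRatio Lc (n + 1)) (b.1 : Site (d + 1)) (b.1 : Site (d + 1)) (Sum.inl b.2) (Sum.inl b.2)
          * perF (towerTorus Lc M' (n + 1)) A (fN a) (b.1, Sum.inl b.2))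
      (-((perF (towerTorus Lc M' (n + 1)) A).submatrix fN fN)) :=
  packedLeg_oneShot_eq_of_blocks Lc M' rs hrs (n + 1) hM' hA hMh hAt hMt hrel hmm hanti fN hfN hmN hcN hH hQ

/-- [folklore] **(S3-1)-F, TORUS RULES IN THE TOWER's SPELLING** (#41d `hEAF ∕ hAEF` with `ρF := bigRoot Lc (rs ∘ succ) n`, `LFc := bigRatio Lc n`, the torus
spelled `towerTorus Lc M′ (n+1)`): §1 at `(fine Lc M′, rs ∘ succ, n)` — `towerTorus_succ` is `rfl`; `Lc ∣ fine Lc M′ i` always. -/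
theorem towerF_rules (hA : Spr A) (hMh : Spr Mh)
    (hAt : ∀ t : Fin (d + 1) → ℤ, shiftK ((bigRatio Lc n : ℤ) • t) A = A) (hMt : ∀ t : Fin (d + 1) → ℤ, shiftK ((bigRatio Lc n : ℤ) • t) Mh = Mh)
    (hrel : RelInv A Mh (axEc (bigRoot Lc (fun k => rs (k + 1)) n) (bigRatio Lc n))) :
    perF (towerTorus Lc M' (n + 1)) (axEc (bigRoot Lc (fun k => rs (k + 1)) n) (bigRatio Lc n)) * perF (towerTorus Lc M' (n + 1)) A
        = perF (towerTorus Lc M' (n + 1)) A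
      ∧ perF (towerTorus Lc M' (n + 1)) A * perF (towerTorus Lc M' (n + 1)) (axEc (bigRoot Lc (fun k => rs (k + 1)) n) (bigRatio Lc n))
        = perF (towerTorus Lc M' (n + 1)) A :=
  ⟨(perF_rules_oneShot_of_relInv Lc (fine Lc M') (fun k => rs (k + 1)) n (fun i => ⟨M' i, rfl⟩) hA hMh hAt hMt hrel).1,
    (perF_rules_oneShot_of_relInv Lc (fine Lc M') (fun k => rs (k + 1)) n (fun i => ⟨M' i, rfl⟩) hA hMh hAt hMt hrel).2.1⟩

set_option synthInstance.maxSize 1024 in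
/-- [folklore] **(S3-1)-F, RIGHT INVERSE IN THE TOWER's SPELLING** (#41d `hXF` with `XF := (kkt H₀ [Q₁₀; τ₁])⁻¹`, `τ₁ = bigP Lc (fine Lc M′) (rs ∘ succ) _ n`,
slots `fF : (pbox M′ × Fin) → Idx (towerTorus Lc M′ (n+1))`): §1 at `(fine Lc M′, rs ∘ succ, n)`; the block identifications `hH : M̂_F|ff = H₀` and
`hQ : M̂_F.submatrix fF (ff) = Q₁₀` (= `compRows Lc M′ lev rs (n+1)`, #41d's `hQ₁₀`) are (C1)'s. -/
theorem towerF_rightInverse (hA : Spr A) (hMh : Spr Mh)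
    (hAt : ∀ t : Fin (d + 1) → ℤ, shiftK ((bigRatio Lc n : ℤ) • t) A = A) (hMt : ∀ t : Fin (d + 1) → ℤ, shiftK ((bigRatio Lc n : ℤ) • t) Mh = Mh)
    (hrel : RelInv A Mh (axEc (bigRoot Lc (fun k => rs (k + 1)) n) (bigRatio Lc n)))
    (hmm : ∀ (x y : Fin (d + 1) → ℤ) (κ l : Fin (d + 1)), Mh x y (Sum.inr κ) (Sum.inr l) = 0)
    (hanti : ∀ (x y : Fin (d + 1) → ℤ) (κ l : Fin (d + 1)), Mh x y (Sum.inl κ) (Sum.inr l) = -Mh y x (Sum.inr l) (Sum.inl κ))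
    (fF : (↥(pbox M') × Fin (d + 1)) → Idx (towerTorus Lc M' (n + 1)) (Fib d)) (hfF : Function.Injective fF)
    (hmF : ∀ a : (↥(pbox M') × Fin (d + 1)), ∃ m : Fin (d + 1), (fF a).2 = Sum.inr m)
    (hcF : ∀ (s : ↥(pbox (towerTorus Lc M' (n + 1)))) (m : Fin (d + 1)),
      ((s, Sum.inr m) : Idx (towerTorus Lc M' (n + 1)) (Fib d)) ∈ Set.range fF ↔ Torus.proj (bigRatio Lc n) (s : Site (d + 1)) = 0)
    {H₀ : Matrix (↥(pbox (towerTorus Lc M' (n + 1))) × Fin (d + 1)) (↥(pbox (towerTorus Lc M' (n + 1))) × Fin (d + 1)) ℝ}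
    (hH : (perF (towerTorus Lc M' (n + 1)) Mh).submatrix
        (fun b : ↥(pbox (towerTorus Lc M' (n + 1))) × Fin (d + 1) => ((b.1, Sum.inl b.2) : Idx (towerTorus Lc M' (n + 1)) (Fib d)))
        (fun b : ↥(pbox (towerTorus Lc M' (n + 1))) × Fin (d + 1) => ((b.1, Sum.inl b.2) : Idx (towerTorus Lc M' (n + 1)) (Fib d))) = H₀)
    {Q₁₀ : Matrix (↥(pbox M') × Fin (d + 1)) (↥(pbox (towerTorus Lc M' (n + 1))) × Fin (d + 1)) ℝ}
    (hQ : (perF (towerTorus Lc M' (n + 1)) Mh).submatrix fF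
        (fun b : ↥(pbox (towerTorus Lc M' (n + 1))) × Fin (d + 1) => ((b.1, Sum.inl b.2) : Idx (towerTorus Lc M' (n + 1)) (Fib d))) = Q₁₀) :
    kkt H₀ (fromRows Q₁₀ (bigP Lc (fine Lc M') (fun k => rs (k + 1)) (fun k => hrs (k + 1)) n))
        * (kkt H₀ (fromRows Q₁₀ (bigP Lc (fine Lc M') (fun k => rs (k + 1)) (fun k => hrs (k + 1)) n)))⁻¹ = 1 :=
  kkt_mul_inv_oneShot_of_blocks Lc (fine Lc M') (fun k => rs (k + 1)) (fun k => hrs (k + 1)) n (fun i => ⟨M' i, rfl⟩) hA hMh hAt hMt hrel hmm hanti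
    fF hfF hmF hcF hH hQ

set_option synthInstance.maxSize 1024 in
/-- [folklore] **(S3-1)-F, THE LEG IN THE TOWER's SPELLING** (#41d `hLF` :215–223 verbatim with `AF := A`, `ρF := bigRoot Lc (rs ∘ succ) n`, `LFc := bigRatio Lc n`;
every torus `towerTorus Lc M′ (n+1)`): §1 at `(fine Lc M′, rs ∘ succ, n)` by `exact` — SPEC #42 (3)'s spelling CHECK, passed in the kernel. -/
theorem towerF_leg (hA : Spr A) (hMh : Spr Mh)
    (hAt : ∀ t : Fin (d + 1) → ℤ, shiftK ((bigRatio Lc n : ℤ) • t) A = A) (hMt : ∀ t : Fin (d + 1) → ℤ, shiftK ((bigRatio Lc n : ℤ) • t) Mh = Mh)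
    (hrel : RelInv A Mh (axEc (bigRoot Lc (fun k => rs (k + 1)) n) (bigRatio Lc n)))
    (hmm : ∀ (x y : Fin (d + 1) → ℤ) (κ l : Fin (d + 1)), Mh x y (Sum.inr κ) (Sum.inr l) = 0)
    (hanti : ∀ (x y : Fin (d + 1) → ℤ) (κ l : Fin (d + 1)), Mh x y (Sum.inl κ) (Sum.inr l) = -Mh y x (Sum.inr l) (Sum.inl κ))
    (fF : (↥(pbox M') × Fin (d + 1)) → Idx (towerTorus Lc M' (n + 1)) (Fib d)) (hfF : Function.Injective fF)
    (hmF : ∀ a : (↥(pbox M') × Fin (d + 1)), ∃ m : Fin (d + 1), (fF a).2 = Sum.inr m)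
    (hcF : ∀ (s : ↥(pbox (towerTorus Lc M' (n + 1)))) (m : Fin (d + 1)),
      ((s, Sum.inr m) : Idx (towerTorus Lc M' (n + 1)) (Fib d)) ∈ Set.range fF ↔ Torus.proj (bigRatio Lc n) (s : Site (d + 1)) = 0)
    {H₀ : Matrix (↥(pbox (towerTorus Lc M' (n + 1))) × Fin (d + 1)) (↥(pbox (towerTorus Lc M' (n + 1))) × Fin (d + 1)) ℝ}
    (hH : (perF (towerTorus Lc M' (n + 1)) Mh).submatrix
        (fun b : ↥(pbox (towerTorus Lc M' (n + 1))) × Fin (d + 1) => ((b.1, Sum.inl b.2) : Idx (towerTorus Lc M' (n + 1)) (Fib d)))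
        (fun b : ↥(pbox (towerTorus Lc M' (n + 1))) × Fin (d + 1) => ((b.1, Sum.inl b.2) : Idx (towerTorus Lc M' (n + 1)) (Fib d))) = H₀)
    {Q₁₀ : Matrix (↥(pbox M') × Fin (d + 1)) (↥(pbox (towerTorus Lc M' (n + 1))) × Fin (d + 1)) ℝ}
    (hQ : (perF (towerTorus Lc M' (n + 1)) Mh).submatrix fF
        (fun b : ↥(pbox (towerTorus Lc M' (n + 1))) × Fin (d + 1) => ((b.1, Sum.inl b.2) : Idx (towerTorus Lc M' (n + 1)) (Fib d))) = Q₁₀) :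
    ((kkt H₀ (fromRows Q₁₀ (bigP Lc (fine Lc M') (fun k => rs (k + 1)) (fun k => hrs (k + 1)) n)))⁻¹).submatrix (Sum.map id Sum.inl) (Sum.map id Sum.inl)
      = fromBlocks
      (Matrix.of fun (b b' : (↥(pbox (towerTorus Lc M' (n + 1))) × Fin (d + 1))) =>
        axEc (bigRoot Lc (fun k => rs (k + 1)) n) (bigRatio Lc n) (b.1 : Site (d + 1)) (b.1 : Site (d + 1)) (Sum.inl b.2) (Sum.inl b.2)
          * (axEc (bigRoot Lc (fun k => rs (k + 1)) n) (bigRatio Lc n) (b'.1 : Site (d + 1)) (b'.1 : Site (d + 1)) (Sum.inl b'.2) (Sum.inl b'.2)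
            * perF (towerTorus Lc M' (n + 1)) A (b.1, Sum.inl b.2) (b'.1, Sum.inl b'.2)))
      (Matrix.of fun (b : (↥(pbox (towerTorus Lc M' (n + 1))) × Fin (d + 1))) (a : (↥(pbox M') × Fin (d + 1))) =>
        axEc (bigRoot Lc (fun k => rs (k + 1)) n) (bigRatio Lc n) (b.1 : Site (d + 1)) (b.1 : Site (d + 1)) (Sum.inl b.2) (Sum.inl b.2)
          * perF (towerTorus Lc M' (n + 1)) A (b.1, Sum.inl b.2) (fF a))
      (-Matrix.of fun (a : (↥(pbox M') × Fin (d + 1))) (b : (↥(pbox (towerTorus Lc M' (n + 1))) × Fin (d + 1))) =>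
        axEc (bigRoot Lc (fun k => rs (k + 1)) n) (bigRatio Lc n) (b.1 : Site (d + 1)) (b.1 : Site (d + 1)) (Sum.inl b.2) (Sum.inl b.2)
          * perF (towerTorus Lc M' (n + 1)) A (fF a) (b.1, Sum.inl b.2))
      (-((perF (towerTorus Lc M' (n + 1)) A).submatrix fF fF)) :=
  packedLeg_oneShot_eq_of_blocks Lc (fine Lc M') (fun k => rs (k + 1)) (fun k => hrs (k + 1)) n (fun i => ⟨M' i, rfl⟩) hA hMh hAt hMt hrel hmm hanti
    fF hfF hmF hcF hH hQ

end Tower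

end Summit.QuantumFields.BalabanUV.Beta.FP.PackedLegOneShotSockets

end
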